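import Mathlib
import Summits.NavierStokesRegularity.NavierStokesRegularity.Theses.LevelSetModeration

/-!
# Sketch — crux-ideate `stmt-NavierStokesRegularity-18150` (`LevelSetClosure`), round 1, ideator 2

First lemmas of the two idea cards `volume-recursion` (A) and `two-level-stampacchia` (B), the
shared PDE-free transfer target `LevelSetExtinction` (C⁺) and the KERNEL-CHECKED transfer
`levelSetClosure_of_extinction : LevelSetExtinction → LevelSetEnergyInequality → LevelSetClosure`.
Everything is stated over existing declarations (route file + Mathlib); statements marked
`Prop` are signatures only (to be proved by the line), the transfer theorem is proved here.
-/

noncomputable section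

-- single-conjunct summit: `Summit.<Summit>.<Problem>` repeats the name by the D-0017 layout
set_option linter.dupNamespace false

open MeasureTheory Set Filter Topology Function
open scoped ENNReal NNReal RealInnerProductSpace

namespace Summit.NavierStokesRegularity.NavierStokesRegularity.Cruxes.LevelSetClosure.Sketch

open Summit.NavierStokesRegularity.NavierStokesRegularity.Theses.LevelSetModeration
open Literature.Analysis.FluidPDE

/-- Physical space. -/
local notation "E3" => EuclideanSpace ℝ (Fin 3)

/-! ### The crux's own currency: level-set functionals of the speed `s = ‖u‖` -/

/-- `V(c)`: space–time volume of the super-level set `{‖u‖ > c}` over `(0,T)` (toReal, verbatim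
the factor inside the crux hypothesis). -/
def levelVolume (u : ℝ → E3 → E3) (T c : ℝ) : ℝ :=
  (∫⁻ τ in Ioo 0 T, volume {x | c < ‖u τ x‖}).toReal

/-- `D_c(t)`: level-set dissipation of the speed over `(0,t)` (toReal, verbatim the crux's). -/
def levelDissipation (u : ℝ → E3 → E3) (t c : ℝ) : ℝ :=
  (∫⁻ τ in Ioo 0 t, ∫⁻ x, {x | c < ‖u τ x‖}.indicator
    (fun x => ENNReal.ofReal (‖fderiv ℝ (fun y => ‖u τ y‖) x‖ ^ 2)) x).toReal

/-- `E_c(t) = ∫ (‖u(t)‖ - c)₊²`: slice level-set energy (verbatim 18151's left-hand side). -/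
def levelEnergy (u : ℝ → E3 → E3) (t c : ℝ) : ℝ :=
  ∫ x, (max (‖u t x‖ - c) 0) ^ 2

/-- **CLI** — the COMBINED level-set inequality: `LevelSetEnergyInequality` (item 18151) chained
with the crux hypothesis; the pressure is gone. This is the only place NS enters the closure. -/
def CLI (ν T Λ m M₀ : ℝ) (u : ℝ → E3 → E3) : Prop :=
  ∀ (M c t : ℝ), M₀ ≤ M → M / 2 ≤ c → c ≤ M → t ∈ Ico 0 T →
    levelEnergy u t c + 2 * ν * levelDissipation u t c ≤
      2 * (Real.sqrt (Λ * M ^ m * levelVolume u T c) * Real.sqrt (levelDissipation u T c))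

/-- The C¹ quadratic-spline truncation at level `k` with ramp `δ`: `0` below `k`, `(s-k)²/(2δ)` on
`[k, k+δ]`, slope `1` after. `spline k δ ∘ ‖·‖` is `C¹` on `E3` for `k > 0` and is the function fed
to the whole-space Gagliardo–Nirenberg–Sobolev inequality (no kink, no compact support needed). -/
def spline (k δ s : ℝ) : ℝ :=
  if s ≤ k then 0 else if s ≤ k + δ then (s - k) ^ 2 / (2 * δ) else s - k - δ / 2

/-- Regularity/size facts of the spline truncation the line needs (signature). -/
def SplineFacts : Prop :=
  ∀ (k δ : ℝ), 0 < k → 0 < δ →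
    ContDiff ℝ 1 (fun v : E3 => spline k δ ‖v‖) ∧
    (∀ s, 0 ≤ spline k δ s ∧ spline k δ s ≤ max (s - k) 0) ∧
    (∀ s, k + δ ≤ s → (s - k) / 2 ≤ spline k δ s) ∧
    (∀ v : E3, ‖fderiv ℝ (fun w : E3 => spline k δ ‖w‖) v‖ ≤
      {w : E3 | k < ‖w‖}.indicator (fun w => ‖fderiv ℝ (fun y : E3 => ‖y‖) w‖) v)

/-! ### Shared transfer target C⁺: PDE-free extinction -/

/-- **C⁺ (`LevelSetExtinction`)**: a jointly continuous field on `[0,T) × ℝ³` with `C¹`,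
square-integrable slices of uniformly bounded energy, initially below `M₀/2`, and obeying CLI for
every `M ≥ M₀`, is bounded on `[0,T)`. No Navier–Stokes, no pressure, no Leray–Hopf structure. -/
def LevelSetExtinction : Prop :=
  ∀ (ν T Λ m M₀ E₀ : ℝ), 0 < ν → 0 < T → m < 10 / 3 → 0 < M₀ →
  ∀ (u : ℝ → E3 → E3),
    ContinuousOn (uncurry u) (Ico 0 T ×ˢ univ) →
    (∀ t ∈ Ico 0 T, ContDiff ℝ 1 (u t)) →
    (∀ t ∈ Ico 0 T, MemLp (u t) 2 volume) →
    (∀ t ∈ Ico 0 T, ∫ x, ‖u t x‖ ^ 2 ≤ E₀) →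
    (∀ x, ‖u 0 x‖ ≤ M₀ / 2) →
    CLI ν T Λ m M₀ u →
    ∃ B : ℝ, ∀ t ∈ Ico 0 T, ∀ x, ‖u t x‖ ≤ B

/-- **Transfer (kernel-checked)**: C⁺ and item 18151 give the crux BY NAME. The Leray–Hopf
structure is used only through `memLp` and the crude energy inequality `‖u(t)‖₂ ≤ ‖u₀‖₂`; no weak
gradient is identified with `∇u`, no decay fact is used. -/
theorem levelSetClosure_of_extinction (hX : LevelSetExtinction) (hE : LevelSetEnergyInequality) :
    LevelSetClosure := by
  intro ν T hν hT u p hcl hLH hdec m Λ M₀ hm hM₀ hu0 hPW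
  refine hX ν T Λ m M₀ (2 * VectorCalculus.kineticEnergy (u 0)) hν hT hm hM₀ u ?_ ?_ ?_ ?_ hu0 ?_
  · exact hcl.smooth_velocity.continuousOn
  · intro t ht
    exact (hcl.contDiff_velocity ht).of_le (by exact_mod_cast le_top)
  · intro t ht
    exact hLH.memLp t (Ico_subset_Icc_self ht)
  · intro t ht
    obtain ⟨G, -, hineq⟩ := hLH.energy_ineq_zero
    have h := hineq t (Ico_subset_Icc_self ht)
    simp only [Pi.zero_apply, inner_zero_left, integral_zero, intervalIntegral.integral_zero,
      add_zero] at h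
    have hK : VectorCalculus.kineticEnergy (u t) ≤ VectorCalculus.kineticEnergy (u 0) :=
      le_trans (le_add_of_nonneg_right (mul_nonneg hν.le ENNReal.toReal_nonneg)) h
    have h2 : ∫ x, ‖u t x‖ ^ 2 = 2 * VectorCalculus.kineticEnergy (u t) := by
      unfold VectorCalculus.kineticEnergy; ring
    linarith
  · intro M c t hM hc hcM ht
    have hc0 : 0 < c := by linarith
    have hcu : ∀ x, ‖u 0 x‖ ≤ c := fun x => by linarith [hu0 x]
    have h1 := hE ν T hν hT u p hcl hLH hdec c hc0 hcu t ht
    have h2 := hPW M c t hM hc hcM hc0 ht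
    show levelEnergy u t c + 2 * ν * levelDissipation u t c ≤
      2 * (Real.sqrt (Λ * M ^ m * levelVolume u T c) * Real.sqrt (levelDissipation u T c))
    unfold levelEnergy levelDissipation levelVolume
    linarith

/-! ### Idea A `volume-recursion`: iterate the space–time VOLUME (De Giorgi 1957 bookkeeping) -/

/-- **FIRST LEMMA of idea A** — two-level Chebyshev–Sobolev gain for ONE slice, PDE-free and
junk-free (in `ℝ≥0∞`): Chebyshev on `L^{10/3}` for the spline truncation at level `k`, Hölder
`10/3 = (2/5)·2 ⊕ (3/5)·6` (`lintegral_enorm_rpow_ten_thirds_le`) and the tree's whole-space GNS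
`eLpNorm_six_le_eLpNorm_fderiv_two` (C¹ ∩ L², constant `SNormLESNormFDerivOfEqConst ℝ volume 2`). -/
def SliceVolumeGain : Prop :=
  ∀ (v : E3 → E3), ContDiff ℝ 1 v → MemLp v 2 volume → ∀ (k h : ℝ), 0 < k → k < h →
    volume {x | h < ‖v x‖} ≤
      ENNReal.ofReal ((4 / (h - k)) ^ (10 / 3 : ℝ)) *
        (SNormLESNormFDerivOfEqConst ℝ (volume : Measure E3) 2 : ℝ≥0∞) ^ (2 : ℕ) *
        (∫⁻ x, ENNReal.ofReal ((max (‖v x‖ - k) 0) ^ 2)) ^ (2 / 3 : ℝ) *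
        ∫⁻ x, {x | k < ‖v x‖}.indicator
          (fun x => ENNReal.ofReal (‖fderiv ℝ (fun y => ‖v y‖) x‖ ^ 2)) x

/-- Idea A, recursion step (signature): integrate `SliceVolumeGain` in time; CLI converts the slice
energy (pointwise in `t`, bound `2ΛM^mV(k)/ν`) and the dissipation (`ΛM^mV(k)/ν²`, after the
one-line absorption `2νD ≤ 2√(ΛM^mVD)`) into powers of `V(k)` — an AUTONOMOUS recursion for the
volume profile, no supremum object, no energy functional. -/
def VolumeRecursionStep : Prop :=
  ∃ A : ℝ, 0 < A ∧ ∀ (ν T Λ m M₀ : ℝ), 0 < ν → 0 < T → 0 < M₀ → 0 < Λ →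
  ∀ (u : ℝ → E3 → E3), ContinuousOn (uncurry u) (Ico 0 T ×ˢ univ) →
    (∀ t ∈ Ico 0 T, ContDiff ℝ 1 (u t)) → (∀ t ∈ Ico 0 T, MemLp (u t) 2 volume) →
    CLI ν T Λ m M₀ u →
    ∀ (M k h : ℝ), M₀ ≤ M → M / 2 ≤ k → k < h → h ≤ M →
      levelVolume u T h ≤
        A * (SNormLESNormFDerivOfEqConst ℝ (volume : Measure E3) 2 : ℝ) ^ 2 *
          Λ ^ (5 / 3 : ℝ) / ν ^ (8 / 3 : ℝ) * M ^ (5 * m / 3) / (h - k) ^ (10 / 3 : ℝ) *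
          levelVolume u T k ^ (5 / 3 : ℝ)

/-- Idea A, endgame (signature): zero space–time volume of an OPEN super-level set of a continuous
field forces it to be empty (`IsOpen.measure_eq_zero_iff`-type fact for Lebesgue measure on
`ℝ × ℝ³`, via Tonelli for the iterated `lintegral`). -/
def OpenNullEmpty : Prop :=
  ∀ (T M : ℝ) (u : ℝ → E3 → E3), ContinuousOn (uncurry u) (Ico 0 T ×ˢ univ) →
    (∫⁻ τ in Ioo 0 T, volume {x | M < ‖u τ x‖}) = 0 → ∀ t ∈ Ioo 0 T, ∀ x, ‖u t x‖ ≤ M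

/-! ### Idea B `two-level-stampacchia`: monotone energy PROFILE + Stampacchia's lemma -/

/-- `U(c) = sup_{t<T} E_c(t) + 2ν D_c(T)`: the level-set energy profile (nonincreasing in `c`). -/
def levelProfile (u : ℝ → E3 → E3) (ν T c : ℝ) : ℝ :=
  sSup ((fun t => levelEnergy u t c) '' Ico 0 T) + 2 * ν * levelDissipation u T c

/-- **FIRST LEMMA of idea B** — Stampacchia's extinction lemma (Kinderlehrer–Stampacchia, Ch. II,
Lemma B.1): a nonnegative nonincreasing `φ` on `[k₀, ∞)` with the two-level gain
`φ(h) ≤ C (h-k)^{-α} φ(k)^β`, `β > 1`, VANISHES at the finite level `k₀ + d`,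
`d^α ≥ C φ(k₀)^{β-1} 2^{αβ/(β-1)}`. (Pure real analysis; follows from the landed `IterationLemma`
at the dyadic levels `k₀ + d(1 - 2^{-j})` and monotonicity.) -/
def StampacchiaLemma : Prop :=
  ∀ (φ : ℝ → ℝ) (k₀ d C α β : ℝ), 0 < C → 0 < α → 1 < β → 0 < d →
    (∀ h, k₀ ≤ h → 0 ≤ φ h) → AntitoneOn φ (Ici k₀) →
    (∀ k h, k₀ ≤ k → k < h → h ≤ k₀ + d → φ h ≤ C / (h - k) ^ α * φ k ^ β) →
    C * φ k₀ ^ (β - 1) * 2 ^ (α * β / (β - 1)) ≤ d ^ α → φ (k₀ + d) = 0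

/-- An elementary identity used twice below: `((1/2)^n)^α = ((2^α)⁻¹)^n`. -/
theorem half_pow_rpow (α : ℝ) : ∀ n : ℕ, (((2:ℝ)⁻¹) ^ n) ^ α = (((2:ℝ) ^ α)⁻¹) ^ n := by
  intro n
  induction n with
  | zero => simp
  | succ n ih =>
      rw [pow_succ, Real.mul_rpow (by positivity) (by positivity), ih, pow_succ,
        Real.inv_rpow (by positivity)]

/-- **Stampacchia's lemma from the landed `IterationLemma`** (kernel-checked reduction): evaluate the
two-level gain at the dyadic levels `c_j = k₀ + d(1 - 2^{-j})`, normalise `W_j = L φ(c_j)` with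
`L^{β-1} = C d^{-α}`, run `IterationLemma` with constant `2^α`, and pass to the limit by monotonicity. -/
theorem stampacchia_of_iterationLemma (hI : IterationLemma) : StampacchiaLemma := by
  intro φ k₀ d C α β hC hα hβ hd hφ0 hanti hrec hsize
  -- dyadic levels
  set c : ℕ → ℝ := fun j => k₀ + d * (1 - (2:ℝ)⁻¹ ^ j) with hc
  have hc_ge : ∀ j, k₀ ≤ c j := fun j => by
    have : (2:ℝ)⁻¹ ^ j ≤ 1 := pow_le_one₀ (by norm_num) (by norm_num)
    simp only [hc]; nlinarith
  have hc_le : ∀ j, c j ≤ k₀ + d := fun j => by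
    have : 0 ≤ (2:ℝ)⁻¹ ^ j := by positivity
    simp only [hc]; nlinarith
  have hgap : ∀ j, c (j + 1) - c j = d * (2:ℝ)⁻¹ ^ (j + 1) := fun j => by
    simp only [hc, pow_succ]; ring
  have hc_lt : ∀ j, c j < c (j + 1) := fun j => by
    have h := hgap j
    have : 0 < d * (2:ℝ)⁻¹ ^ (j + 1) := by positivity
    linarith
  -- the normalising constant `L = (C / d^α)^{1/(β-1)}`
  have hβ1 : 0 < β - 1 := by linarith
  have hdα : 0 < d ^ α := Real.rpow_pos_of_pos hd α
  have hCd : 0 < C / d ^ α := div_pos hC hdα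
  set L : ℝ := (C / d ^ α) ^ (1 / (β - 1)) with hL
  have hLpos : 0 < L := Real.rpow_pos_of_pos hCd _
  have hLpow : L ^ (β - 1) = C / d ^ α := by
    rw [hL, ← Real.rpow_mul hCd.le, one_div_mul_cancel hβ1.ne', Real.rpow_one]
  have hLβ : L ^ β = L * (C / d ^ α) := by
    rw [show β = 1 + (β - 1) by ring, Real.rpow_add hLpos, Real.rpow_one, hLpow]
  have h2α : (0:ℝ) < (2:ℝ) ^ α := Real.rpow_pos_of_pos (by norm_num) α
  have h2αne : (2:ℝ) ^ α ≠ 0 := h2α.ne'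
  have hdαne : d ^ α ≠ 0 := hdα.ne'
  -- the normalised sequence and its recurrence
  set W : ℕ → ℝ := fun j => L * φ (c j) with hW
  have hW0 : ∀ j, 0 ≤ W j := fun j => mul_nonneg hLpos.le (hφ0 _ (hc_ge j))
  have hWrec : ∀ j, W (j + 1) ≤ ((2:ℝ) ^ α) ^ (j + 1) * W j ^ β := by
    intro j
    have hφj : 0 ≤ φ (c j) := hφ0 _ (hc_ge j)
    have h1 := hrec (c j) (c (j + 1)) (hc_ge j) (hc_lt j) (hc_le (j + 1))
    rw [hgap, Real.mul_rpow hd.le (by positivity), half_pow_rpow] at h1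
    have hq : 0 < (((2:ℝ) ^ α)⁻¹) ^ (j + 1) := by positivity
    calc W (j + 1) = L * φ (c (j + 1)) := rfl
      _ ≤ L * (C / (d ^ α * (((2:ℝ) ^ α)⁻¹) ^ (j + 1)) * φ (c j) ^ β) :=
          mul_le_mul_of_nonneg_left h1 hLpos.le
      _ = ((2:ℝ) ^ α) ^ (j + 1) * W j ^ β := by
          have hpne : ((2:ℝ) ^ α) ^ (j + 1) ≠ 0 := pow_ne_zero _ h2αne
          simp only [hW]
          rw [Real.mul_rpow hLpos.le hφj, hLβ, inv_pow]
          field_simp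
  -- the threshold: `W 0 ≤ (2^α)^{-(β/(β-1)²)}`
  have hx0 : 0 ≤ φ k₀ := hφ0 _ le_rfl
  have hβ1ne : β - 1 ≠ 0 := hβ1.ne'
  have hstart : W 0 ≤ ((2:ℝ) ^ α) ^ (-(β / (β - 1) ^ 2)) := by
    have hP0 : (0:ℝ) < (2:ℝ) ^ (α * β / (β - 1)) := Real.rpow_pos_of_pos (by norm_num) _
    have h1 : φ k₀ ^ (β - 1) ≤ d ^ α / (C * (2:ℝ) ^ (α * β / (β - 1))) := by
      rw [le_div_iff₀ (by positivity)]
      calc φ k₀ ^ (β - 1) * (C * (2:ℝ) ^ (α * β / (β - 1)))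
          = C * φ k₀ ^ (β - 1) * (2:ℝ) ^ (α * β / (β - 1)) := by ring
        _ ≤ d ^ α := hsize
    have h2 : φ k₀ ≤ (d ^ α / (C * (2:ℝ) ^ (α * β / (β - 1)))) ^ (1 / (β - 1)) := by
      have h := Real.rpow_le_rpow (Real.rpow_nonneg hx0 _) h1 (le_of_lt (one_div_pos.2 hβ1))
      rwa [← Real.rpow_mul hx0, mul_one_div_cancel hβ1ne, Real.rpow_one] at h
    have hP : ((2:ℝ) ^ (α * β / (β - 1)))⁻¹ = (2:ℝ) ^ (-(α * β / (β - 1))) := by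
      rw [Real.rpow_neg (show (0:ℝ) ≤ 2 by norm_num)]
    have hLinv : L⁻¹ = (d ^ α / C) ^ (1 / (β - 1)) := by
      rw [hL, ← Real.inv_rpow hCd.le, inv_div]
    have hexp : -(α * β / (β - 1)) * (1 / (β - 1)) = α * -(β / (β - 1) ^ 2) := by
      field_simp
    have h3 : (d ^ α / (C * (2:ℝ) ^ (α * β / (β - 1)))) ^ (1 / (β - 1)) =
        L⁻¹ * ((2:ℝ) ^ α) ^ (-(β / (β - 1) ^ 2)) := by
      rw [div_mul_eq_div_div, div_eq_mul_inv (d ^ α / C),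
        Real.mul_rpow (by positivity) (by positivity), ← hLinv, hP,
        ← Real.rpow_mul (show (0:ℝ) ≤ 2 by norm_num),
        ← Real.rpow_mul (show (0:ℝ) ≤ 2 by norm_num), hexp]
    rw [h3] at h2
    have hW0' : W 0 = L * φ k₀ := by simp [hW, hc]
    rw [hW0']
    calc L * φ k₀ ≤ L * (L⁻¹ * ((2:ℝ) ^ α) ^ (-(β / (β - 1) ^ 2))) :=
          mul_le_mul_of_nonneg_left h2 hLpos.le
      _ = ((2:ℝ) ^ α) ^ (-(β / (β - 1) ^ 2)) := by rw [mul_inv_cancel_left₀ hLpos.ne']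
  -- run the iteration lemma
  have h2α1 : (1:ℝ) < (2:ℝ) ^ α := Real.one_lt_rpow (by norm_num) hα
  have hlim : Tendsto W atTop (nhds 0) := hI _ _ h2α1 hβ W hW0 hWrec hstart
  have hlimφ : Tendsto (fun j => φ (c j)) atTop (nhds 0) := by
    have h := hlim.const_mul L⁻¹
    rw [mul_zero] at h
    refine h.congr' (Eventually.of_forall fun j => ?_)
    show L⁻¹ * W j = φ (c j)
    simp only [hW]
    exact inv_mul_cancel_left₀ hLpos.ne' _
  -- monotone passage to the limit
  have hle : ∀ j, φ (k₀ + d) ≤ φ (c j) := fun j =>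
    hanti (hc_ge j) (show k₀ + d ∈ Ici k₀ from by simp [hd.le]) (hc_le j)
  have hge : 0 ≤ φ (k₀ + d) := hφ0 _ (by linarith)
  have : φ (k₀ + d) ≤ 0 := ge_of_tendsto' hlimφ hle
  linarith

/-- Idea B, analytic stub (signature): the TWO-LEVEL GAIN for the profile between two arbitrary
admissible levels `k < h` of one window `[M/2, M]` — the only inequality of the line that touches
measure theory (spline truncation + slice GNS integrated in time + CLI absorption
`U(h) ≤ 8ΛM^m V(h)/ν`). -/
def ProfileGain : Prop :=
  ∃ A : ℝ, 0 < A ∧ ∀ (ν T Λ m M₀ E₀ : ℝ), 0 < ν → 0 < T → 0 < M₀ → 0 < Λ →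
  ∀ (u : ℝ → E3 → E3), ContinuousOn (uncurry u) (Ico 0 T ×ˢ univ) →
    (∀ t ∈ Ico 0 T, ContDiff ℝ 1 (u t)) → (∀ t ∈ Ico 0 T, MemLp (u t) 2 volume) →
    (∀ t ∈ Ico 0 T, ∫ x, ‖u t x‖ ^ 2 ≤ E₀) → CLI ν T Λ m M₀ u →
    ∀ (M k h : ℝ), M₀ ≤ M → M / 2 ≤ k → k < h → h ≤ M →
      levelProfile u ν T h ≤
        A * Λ * (SNormLESNormFDerivOfEqConst ℝ (volume : Measure E3) 2 : ℝ) ^ 2 / ν ^ 2 *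
          M ^ m / (h - k) ^ (10 / 3 : ℝ) * levelProfile u ν T k ^ (5 / 3 : ℝ)

/-- Idea B, base (signature): the profile is NONINCREASING in the level, so the start of every
window is controlled by the floor window: `U(M/2) ≤ U(M₀/2) ≤ E₀ + 2ΛM₀^m V(M₀/2)/ν`, uniformly
in `M ≥ M₀` — the hypothesis at `M = M₀` is the global dissipation certificate. -/
def ProfileBase : Prop :=
  ∀ (ν T Λ m M₀ E₀ : ℝ), 0 < ν → 0 < T → 0 < M₀ → 0 ≤ Λ →
  ∀ (u : ℝ → E3 → E3), (∀ t ∈ Ico 0 T, ∫ x, ‖u t x‖ ^ 2 ≤ E₀) →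
    (∀ t ∈ Ico 0 T, MemLp (u t) 2 volume) → CLI ν T Λ m M₀ u →
    ∀ M, M₀ ≤ M →
      levelProfile u ν T (M / 2) ≤ E₀ + 2 * Λ * M₀ ^ m * (T * (4 * E₀ / M₀ ^ 2)) / ν

end Summit.NavierStokesRegularity.NavierStokesRegularity.Cruxes.LevelSetClosure.Sketch

end
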